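import Summits.CriticalPhenomena.SAWScalingLimit.Theses.SAWDiscreteFlowLine

/-!
# Line `birth` — registered skeleton for the crux `FlowLineStability` (stmt-CriticalPhenomena-8241)

Crux (FIXED; rank 3 of `route-CriticalPhenomena-SAWDiscreteFlowLine`, sub-problem `SAWScalingLimit`;
decl `Summit.CriticalPhenomena.SAWScalingLimit.Theses.SAWDiscreteFlowLine.FlowLineStability`):
for every Dobrushin domain `(D; a, b)`, endpoint approximation `(a_δ, b_δ)`, chordal uniformizer `φ`
and every family of PAIR KERNELS `Kr_δ(v₁, v₂; dh)` (pairs of frozen vertex sequences ↦ field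
measures) whose total field marginal is the face DGFF of `Ω_δ` and which is carried by walks of `Ω_δ`
from `a_δ` to `b_δ` (`WellSupported`), if BOTH slots dress the field well (`DressesWell`: the
imaginary-geometry dressing defect `dft → 0` for every test function, slot by slot) then for every
`ε > 0` the `Kr_δ`-mass of pairs whose polylines are `≥ ε` apart in `CurveClass ℂ` tends to `0`
(`SlotsMerge`).  §1 below transcribes the crux's 31 `let`s VERBATIM as definitions; §2 names its three
clauses; `flowLineStability'_iff : FlowLineStability' ↔ FlowLineStability` is `Iff.rfl`.

## The cut — stability = determination by the field + a union bound

Continuum content of the crux (MillerSheffield2016 = arXiv:1201.1496, Thm 1.1–1.2; Dubedat2009;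
SchrammSheffield2010 Thm 1.3): a curve coupled with the GFF as a flow line IS the flow line `F(h)` —
it is DETERMINED by the field. Determination is a ONE-curve statement; stability of a PAIR is its
corollary through the triangle inequality `dist(γ¹, γ²) ≤ dist(γ¹, F(h)) + dist(F(h), γ²)`. The
skeleton makes exactly this cut on the lattice:

* S1 `stub_fieldDetermination` (HARDEST; XL / open in print): **lattice determination, quantitative
  and uniform over couplings** — for `(D; a, b, φ)` there is a FIELD FUNCTIONAL
  `R : (ε, δ, h) ↦ R ε δ h ∈ CurveClass ℂ` (a lattice reading of the Miller–Sheffield flow line; it may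
  depend on the tolerance `ε` and the mesh `δ`, on nothing else) such that for EVERY well-supported,
  well-dressing pair kernel each slot is `ε`-close to `R ε δ h` with `Kr_δ`-mass `→ 1`
  (`TracksField R Kr`). `R` is quantified BEFORE the kernel: this is what "determined by the field"
  means, and it is the whole analytic content (tightness-free: closeness in probability to ONE
  field-measurable curve, not convergence of laws).
* S2 `stub_unionBound` (size M; measure theory, LANDABLE NOW): for ANY family of pair kernels of unit
  total mass, tracking a common field functional in both slots forces the slots together:
  `TracksField R Kr → SlotsMerge Kr`. Proof: at tolerance `ε/2`,
  `{ε ≤ dist(crv v₁, crv v₂)} × univ ⊆ {h | ε/2 ≤ dist(crv v₁, R h)} ∪ {h | ε/2 ≤ dist(crv v₂, R h)}`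
  pair by pair (triangle inequality in the metric space `CurveClass ℂ`), `measureReal_union_le`, the
  `tsum` over pairs is summable because `Σ_pq Kr_δ(pq)(univ) = 1` (`Measure.sum_apply`,
  `ENNReal.summable_toReal`), `tsum_le_tsum` + `tsum_add`, squeeze (`tendsto_of_tendsto_of_tendsto_of_le_of_le'`)
  with the eventual unit-mass hypothesis.

`FlowLineStability_of` (kernel-checked, no `sorry` of its own): pick `R` from S1, feed S2 with the
unit-mass clause `(WellSupported).1.1` and `TracksField R Kr` from S1; conclude the route decl BY NAME
through `flowLineStability'_iff`.

Why this cut and not compactness + continuum rigidity (the route header's foreseen split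
`ContinuumFlowLineRigidity → LatticeToContinuumDressing`): the continuum GFF/flow-line coupling has no
Literature interface yet (cite wanted C1 of the route: `MillerSheffield2016_thm11/_thm12`), so that split
cannot be typed today; the determination/union-bound cut is typable over the crux's own vocabulary, is
the same mathematics one level up (S1 = "Thm 1.2 on the lattice, uniformly"), and decouples the two
slots, which is what a prover of S1 wants (one path, one field). When the continuum interface lands,
S1 splits further as `JointSubsequentialIGCoupling → ContinuumDetermination → stub_fieldDetermination`.

## Disproof / negatives used — READ THIS before staffing S1

`ledger crux ls stmt-CriticalPhenomena-8241`: no `Disproof.lean`, no `Negative/` lemma (2026-08-17), so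
there is no `_false_without_` theorem to honour. BUT the item carries refuter evidence
(EVIDENCE.md / Scratch.lean, rattack gen-0, 2026-08-15T16:46Z; EVIDENCE2.md / Scratch2.lean / hug.py /
liftcheck, rattack gen-2, 2026-08-15T20:31Z; re-verified by refute-pool g43-8): the crux AS TYPED is
`refuted-misstated` ON PAPER — `IsDP` admits NON-SIMPLE walks, and the deterministic, field-independent
"two-pass shielded boundary hugs" `(vL, vR) ⊗ faceDGFF` are well supported, dress well in both slots
(capacity `O(δ log 1/δ)`, backward-dressed exposed faces carry data `→ 0` since `λ − λ′ = πχ/2`) and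
stay `≥ 0.9` apart. No Lean `¬FlowLineStability` has landed (it would need the face-DGFF measure and
discrete potential theory), the item is OPEN, and the recorded repair is
`C′`: `IsDP := ∃ ω, ω.IsPath ∧ v = ω.getVert` in both slots (route re-audit bin REPAIRABLE).
Consequences for this skeleton, stated plainly:
* `stub_fieldDetermination` INHERITS the misstatement verbatim (the hug pair satisfies its hypotheses
  and `vL`, `vR` cannot both be `ε/2`-close to one `R h`): as typed it is as false as the crux; its TRUE
  content is its restriction to simple paths, which is LITERALLY the S1 of the repaired crux `C′`
  (swap `IsDP` for its `IsPath` form in §1 — one definition; nothing else in this file mentions walks).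
  A prover should work on that restriction and land it `--supports` the repaired item when it exists.
* `stub_unionBound` does not see the support clause at all (only unit total mass): TRUE as typed,
  unaffected by the repair, landable now.
* No stub is an instance a landed Negative lemma refutes (none exists); `ledger negatives --problem
  CriticalPhenomena` (11 entries, 2026-08-17) has nothing on DGFF dressings — the SAW all-`δ` tightness
  negative (stmt-0772) is not touched (every statement here is eventual in `δ`, and no tightness is
  asserted anywhere: S1 is closeness in probability to a field functional, not precompactness of laws).

Vacuity / junk pass (A1–A6): `TracksField`/`SlotsMerge` use `Measure.real` on possibly non-measurable
sets (outer measure; `measureReal_union_le` needs no measurability) and `tsum` over the uncountable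
pair type (summable under unit mass; junk `0` otherwise, harmless: the conclusion is `→ 0`); `R` may be
non-measurable in `h` (allowed: determination functionals are only a.e.-defined in the continuum too);
`ε`-indexed `R` is the weakest form S2 needs (it applies S1 at `ε/2`). Degenerate kernels (`Kr = 0`
eventually) violate unit mass, so `WellSupported` is not vacuous only thanks to `gff`; the refuter's
hug kernels show the hypotheses are satisfiable.
-/

noncomputable section

-- the route file's scopes, re-opened verbatim so that elaboration (instances of the `if`s, coercions,
-- `Measure`, `𝓝[>]`) coincides with the crux's and `flowLineStability'_iff` below is `Iff.rfl`
open scoped BigOperators Topology Manifold Classical MeasureTheory ProbabilityTheory Matrix InnerProductSpace ComplexConjugate ContinuousMap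
open Filter Set Function TopologicalSpace MeasureTheory

namespace Summit.CriticalPhenomena.SAWScalingLimit.Cruxes.FlowLineStability.Birth

open Literature.Probability.RandomPlanarGeometry (DobrushinDomain CurveClass ConformalEquiv)
open Literature.Probability.LatticeModels (Site)

/-- Pairs of frozen vertex sequences (the crux's `let P2`). -/
local notation "P2" => (ℕ → Site 2) × (ℕ → Site 2)

/-- The type of the crux's pair kernels `Kr : δ ↦ (v₁, v₂) ↦ field measure`. -/
local notation "PairKer" => ℝ → (ℕ → Site 2) → (ℕ → Site 2) → Measure (Site 2 → ℝ)

/-- The type of a field-reconstruction functional `R : (ε, δ, h) ↦ curve class` (new in this line). -/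
local notation "Recon" => ℝ → ℝ → (Site 2 → ℝ) → CurveClass ℂ

/-! ### 1. Vocabulary — the crux's `let`s, VERBATIM, as definitions

Parameters replace the ambient binders `D, a, b, φ` of the crux; every body is the corresponding
`let` value with `S := Site 2`, `pi := Real.pi`, `sq := Real.sqrt`, `I := Complex.I`, `ex := Complex.exp`,
`ar := Complex.arg`, `mp := meshPoint` inlined. They are `abbrev`s (reducible) ON PURPOSE: the crux's
`let`-bound names are transparent to instance resolution (e.g. `if f ∈ Fc δ then …` elaborates through
`Set.decidableSetOf` to a conjunction instance), and only reducible definitions reproduce those instances,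
which is what makes `flowLineStability'_iff` below `Iff.rfl`. -/

/-- `Ad δ x y`: adjacency in the discretised domain graph `Ω_δ` (crux `let Ad`). -/
abbrev Ad (D : DobrushinDomain) (δ : ℝ) (x y : Site 2) : Prop :=
  (Literature.Probability.LatticeModels.discreteDomainGraph D.carrier δ).Adj x y

/-- `Fc δ`: the interior FACES of `Ω_δ`, indexed by their lower-left corner (all four sides are edges of
`Ω_δ`) (crux `let Fc`). -/
abbrev Fc (D : DobrushinDomain) (δ : ℝ) : Set (Site 2) :=
  {f : Site 2 | Ad D δ f (f + ![1,0]) ∧ Ad D δ f (f + ![0,1]) ∧ Ad D δ (f + ![1,0]) (f + ![1,1]) ∧ Ad D δ (f + ![0,1]) (f + ![1,1])}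

/-- `ctr δ f`: the centre of the face `f` at mesh `δ` (crux `let ctr`). -/
abbrev ctr (δ : ℝ) (f : Site 2) : ℂ :=
  Literature.Probability.LatticeModels.meshPoint δ f + (δ : ℂ) * (1 + Complex.I) / 2

/-- `Gf A f g`: the killed simple-random-walk Green function of the face set `A` (walk sum on the dual
graph, SRW-normalised) (crux `let Gf`). -/
abbrev Gf (A : Set (Site 2)) (f g : Site 2) : ℝ :=
  ∑' ω : (Literature.Probability.LatticeModels.zdGraph 2).Walk f g, if (∀ x ∈ ω.support, x ∈ A) then ((4 : ℝ)⁻¹) ^ ω.length else 0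

/-- `Hm A z f`: one-step average of `Gf A z ·` over the four neighbours of `f` — the exit kernel /
discrete harmonic measure density used to extend boundary data (crux `let Hm`). -/
abbrev Hm (A : Set (Site 2)) (z f : Site 2) : ℝ :=
  (Gf A z (f + ![1,0]) + Gf A z (f + ![-1,0]) + Gf A z (f + ![0,1]) + Gf A z (f + ![0,-1])) / 4

/-- `lf x y`: the face LEFT of the directed lattice edge `x → y` (case table; crux `let lf`). -/
abbrev lf (x y : Site 2) : Site 2 :=
  if y = x + ![1,0] then x else if y = x + ![0,1] then x + ![-1,0] else if y = x + ![-1,0] then x + ![-1,-1] else x + ![0,-1]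

/-- `rf x y`: the face RIGHT of the directed lattice edge `x → y` (case table; crux `let rf`). -/
abbrev rf (x y : Site 2) : Site 2 :=
  if y = x + ![1,0] then x + ![0,-1] else if y = x + ![0,1] then x else if y = x + ![-1,0] then x + ![-1,0] else x + ![-1,-1]

/-- `Ed v i f`: the face `f` is a side face of the `i`-th (non-degenerate) step of `v` (crux `let Ed`). -/
abbrev Ed (v : ℕ → Site 2) (i : ℕ) (f : Site 2) : Prop :=
  v (i + 1) ≠ v i ∧ (f = lf (v i) (v (i + 1)) ∨ f = rf (v i) (v (i + 1)))

/-- `K v`: the DRESSED (side) faces of the vertex sequence `v` (crux `let K`). -/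
abbrev K (v : ℕ → Site 2) : Set (Site 2) :=
  {f | ∃ i, Ed v i f}

/-- `jf v f`: first step index at which `f` is dressed (`sInf`, junk `0`) (crux `let jf`). -/
abbrev jf (v : ℕ → Site 2) (f : Site 2) : ℕ :=
  sInf {i | Ed v i f}

/-- `bl δ = ⌈δ^{-1/2}⌉`: the smoothing block length (crux `let bl`). -/
abbrev bl (δ : ℝ) : ℕ :=
  ⌈(Real.sqrt δ)⁻¹⌉₊

/-- `pt δ v i`: the `i`-th block vertex of `v` read in the `ℍ`-chart `φ⁻¹` (crux `let pt`). -/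
abbrev pt {D : DobrushinDomain} (φ : ConformalEquiv UpperHalfPlane.upperHalfPlaneSet D.carrier) (δ : ℝ)
    (v : ℕ → Site 2) (i : ℕ) : ℂ :=
  φ.symm (Literature.Probability.LatticeModels.meshPoint δ (v (bl δ * i)))

/-- `ang δ v B`: the LIFTED `ℍ`-angle of the `√δ`-chords of `v` after `B` blocks (first chord against the
upward vertical, then principal turning increments) (crux `let ang`). -/
abbrev ang {D : DobrushinDomain} (φ : ConformalEquiv UpperHalfPlane.upperHalfPlaneSet D.carrier) (δ : ℝ)
    (v : ℕ → Site 2) (B : ℕ) : ℝ :=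
  Real.pi / 2 + Complex.arg ((pt φ δ v 1 - pt φ δ v 0) / Complex.I) + ∑ i ∈ Finset.range B, Complex.arg ((pt φ δ v (i + 2) - pt φ δ v (i + 1)) / (pt φ δ v (i + 1) - pt φ δ v i))

/-- `dat δ v f`: the imaginary-geometry DATA on the dressed face `f` at `κ = 8/3`:
`∓λ′ + χ(α_ℍ − π/2) − λ + (2λ/π) Arg φ⁻¹(ctr f)`, `λ′ = π/√6`, `χ = 1/√6`, `λ = π√(3/8)`
(sign `−` iff `f` is LEFT of its first dressing step) (crux `let dat`). -/
abbrev dat {D : DobrushinDomain} (φ : ConformalEquiv UpperHalfPlane.upperHalfPlaneSet D.carrier) (δ : ℝ)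
    (v : ℕ → Site 2) (f : Site 2) : ℝ :=
  (if f = lf (v (jf v f)) (v (jf v f + 1)) then -1 else 1) * (Real.pi / Real.sqrt 6) + (1 / Real.sqrt 6) * (ang φ δ v (jf v f / bl δ) - Real.pi / 2) - Real.pi * Real.sqrt (3 / 8) + 2 * Real.sqrt (3 / 8) * Complex.arg (φ.symm (ctr δ f))

/-- `U δ v z`: the flow-line DRESSING of `v` — discrete harmonic extension into `Fc δ ∖ K v` of `dat` on
the dressed faces, `0` elsewhere (crux `let U`). -/
abbrev U {D : DobrushinDomain} (φ : ConformalEquiv UpperHalfPlane.upperHalfPlaneSet D.carrier) (δ : ℝ)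
    (v : ℕ → Site 2) (z : Site 2) : ℝ :=
  ∑' f : Site 2, if f ∈ K v then Hm (Fc D δ \ K v) z f * dat φ δ v f else 0

/-- `pr δ ψ w = δ² Σ_{f ∈ Fc δ} ψ(ctr f) w f`: the lattice pairing `⟨w, ψ⟩_δ` (crux `let pr`). -/
abbrev pr (D : DobrushinDomain) (δ : ℝ) (ψ : ℂ → ℝ) (w : Site 2 → ℝ) : ℝ :=
  ∑' f : Site 2, if f ∈ Fc D δ then δ ^ 2 * ψ (ctr δ f) * w f else 0

/-- `Qv δ ψ A = δ⁴ Σ_{f,g ∈ Fc δ} ψ(ctr f) ψ(ctr g) Gf A f g`: the quadratic form `⟨ψ, G_A ψ⟩_δ`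
(crux `let Qv`). -/
abbrev Qv (D : DobrushinDomain) (δ : ℝ) (ψ : ℂ → ℝ) (A : Set (Site 2)) : ℝ :=
  ∑' f : Site 2, ∑' g : Site 2, if f ∈ Fc D δ ∧ g ∈ Fc D δ then δ ^ 4 * ψ (ctr δ f) * ψ (ctr δ g) * Gf A f g else 0

/-- `gff δ μ`: `μ` IS the face DGFF of `Ω_δ` — a probability measure on `Site 2 → ℝ` pinned by its
characteristic functional (centred Gaussian, covariance `Gf (Fc δ)`) (crux `let gff`). -/
abbrev gff (D : DobrushinDomain) (δ : ℝ) (μ : Measure (Site 2 → ℝ)) : Prop :=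
  IsProbabilityMeasure μ ∧ ∀ t : Site 2 →₀ ℝ, ∫ h, Complex.exp (Complex.I * ((∑ f ∈ t.support, t f * h f : ℝ) : ℂ)) ∂μ = Complex.exp (-((∑ f ∈ t.support, ∑ g ∈ t.support, t f * t g * Gf (Fc D δ) f g : ℝ) : ℂ) / 2)

/-- `dfc δ ψ s v h`: the characteristic-function DEFECT of the field `h` against the flow-line
prediction of the path `v`: `e^{i s κ₀⟨h,ψ⟩_δ} − e^{i s⟨U^v,ψ⟩_δ − s²(π/2)⟨ψ,G_{Fc∖K v}ψ⟩_δ/2}`,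
`κ₀ = √(π/2)` (crux `let dfc`). -/
abbrev dfc {D : DobrushinDomain} (φ : ConformalEquiv UpperHalfPlane.upperHalfPlaneSet D.carrier) (δ : ℝ)
    (ψ : ℂ → ℝ) (s : ℝ) (v : ℕ → Site 2) (h : Site 2 → ℝ) : ℂ :=
  Complex.exp (Complex.I * (s * Real.sqrt (Real.pi / 2) * pr D δ ψ h : ℝ)) - Complex.exp (Complex.I * (s * pr D δ ψ (U φ δ v) : ℝ) - ((s ^ 2 * (Real.pi / 2) * Qv D δ ψ (Fc D δ \ K v) / 2 : ℝ) : ℂ))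

/-- `dft δ ψ s ι pre Kr`: the PROGRESSIVE DRESSING DEFECT of a kernel `Kr` indexed by `ι` with prefix
map `pre` — `sup` over prefix times `k` and prefix test functionals `|F| ≤ 1` of
`‖Σ_ξ ∫ F(pre ξ k) · dfc(pre ξ k, h) Kr(ξ; dh)‖` (crux `let dft`). -/
abbrev dft {D : DobrushinDomain} (φ : ConformalEquiv UpperHalfPlane.upperHalfPlaneSet D.carrier) (δ : ℝ)
    (ψ : ℂ → ℝ) (s : ℝ) (ι : Type) (pre : ι → ℕ → ℕ → Site 2) (Kr : ι → Measure (Site 2 → ℝ)) : ℝ :=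
  sSup {r : ℝ | ∃ (k : ℕ) (F : (ℕ → Site 2) → ℝ), (∀ v, |F v| ≤ 1) ∧ r = ‖∑' ξ : ι, ∫ h, (F (pre ξ k) : ℂ) * dfc φ δ ψ s (pre ξ k) h ∂(Kr ξ)‖}

/-- `IsDP δ v`: `v` is the frozen vertex sequence of SOME walk of `Ω_δ` from `a δ` to `b δ` — AS TYPED
in the crux: the walk need NOT be simple (the locus of the recorded misstatement; the repair `C′`
inserts `ω.IsPath ∧` here) (crux `let IsDP`). -/
abbrev IsDP (D : DobrushinDomain) (a b : ℝ → Site 2) (δ : ℝ) (v : ℕ → Site 2) : Prop :=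
  ∃ ω : (Literature.Probability.LatticeModels.discreteDomainGraph D.carrier δ).Walk (a δ) (b δ), v = fun i => ω.getVert i

/-- `len v`: the freezing time of `v` (`sInf`, junk `0` for a never-freezing sequence) (crux `let len`). -/
abbrev len (v : ℕ → Site 2) : ℕ :=
  sInf {n : ℕ | ∀ i, n ≤ i → v i = v n}

/-- `crv δ v`: the polyline of `v` up to its freezing time, as a curve modulo reparametrisation
(crux `let crv`). -/
abbrev crv (δ : ℝ) (v : ℕ → Site 2) : CurveClass ℂ :=
  Literature.Probability.RandomPlanarGeometry.CurveClass.mk ⟨Literature.Probability.LatticeModels.polyline ((List.range (len v + 1)).map (Literature.Probability.LatticeModels.meshPoint δ ∘ v))⟩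

/-! ### 2. The three clauses of the crux, named -/

/-- HYPOTHESIS 1 of the crux (`WellSupported`): eventually in `δ`, the total field marginal
`Σ_{(v₁,v₂)} Kr_δ(v₁, v₂; ·)` is the face DGFF of `Ω_δ`, and every pair charged by `Kr_δ` consists of
(frozen vertex sequences of) walks of `Ω_δ` from `a δ` to `b δ` — `IsDP` AS TYPED, non-simple allowed. -/
def WellSupported (D : DobrushinDomain) (a b : ℝ → Site 2) (Kr : PairKer) : Prop :=
  ∀ᶠ δ in (𝓝[>] 0), gff D δ (Measure.sum (fun pq : P2 => Kr δ pq.1 pq.2)) ∧ ∀ v₁ v₂, Kr δ v₁ v₂ ≠ 0 → IsDP D a b δ v₁ ∧ IsDP D a b δ v₂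

/-- HYPOTHESIS 2 of the crux (`DressesWell`): both slots dress the field well — for every test function
`ψ ∈ C_c(Ω)` and `s ∈ ℝ` the progressive dressing defects of slot 1 and of slot 2 tend to `0`. -/
def DressesWell {D : DobrushinDomain} (φ : ConformalEquiv UpperHalfPlane.upperHalfPlaneSet D.carrier)
    (Kr : PairKer) : Prop :=
  ∀ (ψ : ℂ → ℝ) (s : ℝ), Continuous ψ → HasCompactSupport ψ → tsupport ψ ⊆ D.carrier → Tendsto (fun δ => dft φ δ ψ s P2 (fun pq k i => pq.1 (min i k)) (fun pq => Kr δ pq.1 pq.2)) (𝓝[>] 0) (𝓝 0) ∧ Tendsto (fun δ => dft φ δ ψ s P2 (fun pq k i => pq.2 (min i k)) (fun pq => Kr δ pq.1 pq.2)) (𝓝[>] 0) (𝓝 0)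

/-- CONCLUSION of the crux (`SlotsMerge`): for every `ε > 0` the `Kr_δ`-mass of pairs whose polylines are
`≥ ε` apart in `CurveClass ℂ` tends to `0` as `δ → 0⁺`. -/
def SlotsMerge (Kr : PairKer) : Prop :=
  ∀ ε : ℝ, 0 < ε → Tendsto (fun δ => ∑' pq : P2, if ε ≤ dist (crv δ pq.1) (crv δ pq.2) then (Kr δ pq.1 pq.2).real univ else 0) (𝓝[>] 0) (𝓝 0)

/-- NEW in this line (`TracksField R Kr`): both slots TRACK the field functional `R` — for every `ε > 0`
the `Kr_δ`-mass of `{(v₁, v₂, h) : dist(crv vᵢ, R ε δ h) ≥ ε}` tends to `0`, `i = 1, 2`. -/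
def TracksField (R : Recon) (Kr : PairKer) : Prop :=
  ∀ ε : ℝ, 0 < ε →
    Tendsto (fun δ => ∑' pq : P2, (Kr δ pq.1 pq.2).real {h | ε ≤ dist (crv δ pq.1) (R ε δ h)}) (𝓝[>] 0) (𝓝 0) ∧
    Tendsto (fun δ => ∑' pq : P2, (Kr δ pq.1 pq.2).real {h | ε ≤ dist (crv δ pq.2) (R ε δ h)}) (𝓝[>] 0) (𝓝 0)

/-- The crux with its `let`s zeta-reduced into the §1–§2 vocabulary (definitionally the route decl,
see `flowLineStability'_iff`). -/
def FlowLineStability' : Prop :=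
  ∀ (D : DobrushinDomain) a b, Literature.Probability.RandomPlanarGeometry.SAW.IsEndpointApprox D a b →
    ∀ φ, D.IsChordalUniformizing φ → ∀ Kr : PairKer, WellSupported D a b Kr → DressesWell φ Kr → SlotsMerge Kr

/-- **S1, named — determination by the field** (lattice, quantitative, uniform over couplings).
`@[stub "birth"]` obligation node: an admissible hypothesis of `FlowLineStability_of`. -/
-- @[stub "birth"] (tag live in the registrar work copy bc/FlowLineStability_birth.lean; commented here: crux workfiles may not carry gate-reserved attributes)
def FieldDetermination : Prop :=
  ∀ (D : DobrushinDomain) a b, Literature.Probability.RandomPlanarGeometry.SAW.IsEndpointApprox D a b →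
    ∀ φ, D.IsChordalUniformizing φ →
      ∃ R : Recon, ∀ Kr : PairKer, WellSupported D a b Kr → DressesWell φ Kr → TracksField R Kr

/-- **S2, named — the union bound**: unit total mass + tracking a common field functional in both slots
⇒ the slots merge. `@[stub "birth"]` obligation node: an admissible hypothesis of `FlowLineStability_of`. -/
-- @[stub "birth"] (tag live in the registrar work copy bc/FlowLineStability_birth.lean; commented here: crux workfiles may not carry gate-reserved attributes)
def UnionBound : Prop :=
  ∀ (R : Recon) (Kr : PairKer),
    (∀ᶠ δ in (𝓝[>] 0), IsProbabilityMeasure (Measure.sum (fun pq : P2 => Kr δ pq.1 pq.2))) →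
      TracksField R Kr → SlotsMerge Kr


/-! ### 3. The skeleton — two registered stubs and the kernel-checked composition -/

/-- The §1–§2 vocabulary form IS the route decl: every `let` of the crux zeta-reduces to the
corresponding definition (same scopes, same instances). -/
theorem flowLineStability'_iff :
    FlowLineStability' ↔
      Summit.CriticalPhenomena.SAWScalingLimit.Theses.SAWDiscreteFlowLine.FlowLineStability :=
  Iff.rfl

/-- **Stub S1 — `stub_fieldDetermination` (HARDEST; lattice IG-I Thm 1.2, quantitative, uniform over
couplings).** For every `(D; a, b, φ)` there is ONE field functional `R : (ε, δ, h) ↦ CurveClass ℂ`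
such that every well-supported pair kernel that dresses well in both slots has both slots `ε`-close
to `R ε δ h` with `Kr_δ`-mass `→ 1`. Inherits the crux's `IsDP` (non-simple walks) verbatim — see the
module docstring: its true content is the simple-path restriction (= S1 of the repaired crux `C′`).
Sources: MillerSheffield2016 (arXiv:1201.1496) Thm 1.1–1.2; SchrammSheffield2010 (arXiv:1008.2447)
Thm 1.3 (local sets determined by the field); Dubedat2009. -/
theorem stub_fieldDetermination : FieldDetermination := by
  sorry

/-- **Stub S2 — `stub_unionBound` (measure theory, size M).** Unit total mass eventually + both slots
track a common field functional `R` ⇒ the slots merge: triangle inequality in `CurveClass ℂ` at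
tolerance `ε/2`, `measureReal_union_le` pair by pair, summability of the pair `tsum` from unit mass,
squeeze. True as typed; independent of the `IsDP` repair. -/
theorem stub_unionBound : UnionBound := by
  sorry

/-- **Composition (kernel-checked, no `sorry` of its own).** `S1 → S2 → FlowLineStability`, the route
decl BY NAME: take `R` from S1 at `(D; a, b, φ)`, feed S2 with the unit-mass clause of `WellSupported`
(`gff = IsProbabilityMeasure ∧ …`) and with `TracksField R Kr`. -/
theorem FlowLineStability_of :
    FieldDetermination → UnionBound →
      Summit.CriticalPhenomena.SAWScalingLimit.Theses.SAWDiscreteFlowLine.FlowLineStability := by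
  intro hDet hUB
  rw [← flowLineStability'_iff]
  intro D a b hab φ hφ Kr hWS hDW
  obtain ⟨R, hR⟩ := hDet D a b hab φ hφ
  exact hUB R Kr (hWS.mono fun δ hδ => hδ.1.1) (hR Kr hWS hDW)

/-- **Registered target of the skeleton** — the crux BY NAME with no hypotheses: `FlowLineStability_of`
applied to the two declared stubs (`#print axioms` reaches `sorryAx` exactly through `stub_fieldDetermination`
and `stub_unionBound`). `#h21_check_skeleton` accepts either this theorem (no hypotheses) or
`FlowLineStability_of` (hypotheses = the `@[stub "birth"]` obligation nodes of §2). -/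
theorem FlowLineStability_of_stubs :
    Summit.CriticalPhenomena.SAWScalingLimit.Theses.SAWDiscreteFlowLine.FlowLineStability :=
  FlowLineStability_of stub_fieldDetermination stub_unionBound

end Summit.CriticalPhenomena.SAWScalingLimit.Cruxes.FlowLineStability.Birth

end
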